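import Summits.Ventures.LatticeQCDFlow.Exactness.IMHCoupledEstimatorEquilibriumBernsteinUnboundedWeights
import Summits.Ventures.LatticeQCDFlow.Exactness.IMHCommonRandomNumbersMergedForeverUnboundedWeights
import HarnessLib

/-!
# The EXACTLY UNBIASED (untruncated) coupled estimator obeys the equilibrium error bars WITHOUT A WEIGHT BOUND:
# `P(|R⁻¹Σ_{j<R} H_k(Z_j) − π f| ≥ ε + (c − a)τ) ≤ 2·exp(−2Rε²/(c − a)²) + R·(q{w > M} + ρ^k)` (Hoeffding) and the Bernstein bar at
# `Var_π f + 3(c − a)²τ`, `H_k = f(Y_k) + Σ_{n≥0} D_{k+n}`, `τ = π{w > M} + ρ^k`, `ρ = 1 − E_q[min(1, w)]/max(1, M)`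

HONEST FRAMING: exact (Metropolis-corrected) sampling algorithms for lattice gauge theory;
figures of merit are autocorrelation/cost numbers at stated couplings and volumes; no
continuum-physics claim.

Venture `LatticeQCDFlow` (cell pub-lqcd), topic `Exactness`; FANOUT row 30 (lean-1, GEN-40).  NEW WORK of the cell, general
(standard Borel) state space, EVERY proposal law `q`, EVERY positive normalised weight — no bound on `w`, no moment condition.
GEN-39's `Exactness/IMHCoupledEstimatorBurnInHoeffding` §3 proved the Hoeffding bar for the average of `R` independent copies of the
exactly unbiased estimator `H_k = f(Y_k) + Σ_{n≥0}(f(X′_{k+n}) − f(Y_{k+n}))` under a BOUNDED weight (a replica still carries a correction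
after the burn-in with probability `≤ r^k p₀`).  GEN-40's `IMHCoupledUnbiasedEstimatorEveryWeight` made `H_k` exactly unbiased from the
practical start for EVERY weight; here its certified error bars lose the weight bound too:

* §1 **`crnLag_replica_notMerged_after_le_offDiagonal`**, **`crnLag_replicas_notMerged_after_le_offDiagonal`** — per replica
  `P(∃ m ≥ k, X_m ≠ X′_m) ≤ P(X_k ≠ X′_k) = (ν̂K̂^k)(Δᶜ)` (GEN-40's weight-free `crn_chain_notMerged_after_le_offDiagonal` transferred
  along the law), and the union bound `≤ R·(ν̂K̂^k)(Δᶜ)`; off this event every correction of every replica vanishes.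
* §2 from ANY initial coupling, about `m_k = (ν̂₂K^k) f`, NO weight hypothesis:
  **`crnLag_untruncated_replicas_burnIn_hoeffding_abs_everyWeight`** — `P(|R⁻¹Σ_j H_k(Z_j) − m_k| ≥ ε) ≤ 2·exp(−2Rε²/(c − a)²) + R·(ν̂K̂^k)(Δᶜ)`;
  **`crnLag_untruncated_replicas_burnIn_bernstein_abs_everyWeight`** — `≤ 2·exp(−Rε²/(2(σ² + (c − a)ε/3))) + R·(ν̂K̂^k)(Δᶜ)` for
  `σ² ≥ Var_{ν̂₂K^k} f > 0`.
* §3 the practical start (production run at `x` with `w(x) ≤ M`, leading run one update ahead), ABOUT `π f`, `τ = π{M < w} + ρ^k`: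
  **`crnLag_untruncated_replicas_burnIn_hoeffding_abs_target_everyWeight`** —
  `P(|R⁻¹Σ_j H_k(Z_j) − π f| ≥ ε + (c − a)τ) ≤ 2·exp(−2Rε²/(c − a)²) + R·(q{M < w} + ρ^k)`;
  **`crnLag_untruncated_replicas_burnIn_bernstein_abs_target_equilibrium_everyWeight`** —
  `≤ 2·exp(−Rε²/(2(Var_π f + 3(c − a)²τ + (c − a)ε/3))) + R·(q{M < w} + ρ^k)` (the read-out variance after the burn-in is an equilibrium
  quantity, `IMHCoupledEstimatorEquilibriumBernsteinUnboundedWeights`).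
Reading (gauge files): the average of `R` independent exactly unbiased coupled estimates from two exact gauge samplers on one stream of
random numbers obeys the equilibrium Hoeffding ∕ Bernstein bar up to `R·(q{w > M} + ρ^k)` and the bias allowance `(c − a)τ` — for EVERY
flow, however heavy the tails of its weight; no truncation window is needed.
NOT CLAIMED: a variance bound for `H_k` itself without a weight bound (GEN-38's two-sided variance bounds keep `w ≤ W`); anything for
unbounded `f`.  No `sorry`, no new definitions, nothing cited as a fact.
-/

noncomputable section

namespace Summit.Ventures.LatticeQCDFlow.Exactness

open MeasureTheory ProbabilityTheory Function Finset Filter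
open scoped _root_.ENNReal unitInterval Topology
open Summit.Ventures.LatticeQCDFlow.Scoring

variable {Ω : Type*} [MeasurableSpace Ω] {q : Measure Ω} [IsProbabilityMeasure q] {w : Ω → ℝ}

section Replicas

variable {Ω' : Type*} {mΩ' : MeasurableSpace Ω'} {μ : Measure Ω'} [IsProbabilityMeasure μ]
  {Z : ℕ → Ω' → (ℕ → Ω × Ω)}

/-! ## §1 Not merged after the burn-in: per replica and across replicas, every weight -/

omit [IsProbabilityMeasure μ] in
/-- **PER REPLICA `P(∃ m ≥ k, X_m ≠ X′_m along Z_j) ≤ (ν̂K̂^k)(Δᶜ)`** for EVERY weight (transfer of the weight-free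
`crn_chain_notMerged_after_le_offDiagonal` along the law of the stream). [ours, bookkeeping] -/
theorem crnLag_replica_notMerged_after_le_offDiagonal [MeasurableEq Ω] (hw : Measurable w) (hw0 : ∀ y, 0 < w y)
    (Khat : Kernel (Ω × Ω) (Ω × Ω)) [IsMarkovKernel Khat]
    (hK : ∀ z : Ω × Ω, Khat z = (q.prod (volume : Measure unitInterval)).map (fun p : Ω × unitInterval =>
      ((if (p.2 : ℝ) * w z.1 ≤ w p.1 then p.1 else z.1), (if (p.2 : ℝ) * w z.2 ≤ w p.1 then p.1 else z.2))))
    (ν : Measure (Ω × Ω)) [IsProbabilityMeasure ν] (k : ℕ) (hZm : ∀ j, Measurable (Z j)) {j : ℕ}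
    (hlaw : μ.map (Z j) = Kernel.trajMeasure (X := fun _ : ℕ => Ω × Ω) ν
      (fun n : ℕ => Khat.comap (fun h : (i : ↥(Finset.Iic n)) → Ω × Ω => h ⟨n, Finset.mem_Iic.2 le_rfl⟩)
        (measurable_pi_apply _))) :
    μ.real {ω | ∃ m, k ≤ m ∧ Z j ω m ∉ Set.diagonal Ω} ≤
      ((fun m : Measure (Ω × Ω) => m.bind Khat)^[k] ν).real (Set.diagonal Ω)ᶜ := by
  haveI := isProbabilityMeasure_iterate_bind (κ := Khat) ν k
  have hE : MeasurableSet {z : ℕ → Ω × Ω | ∃ m, k ≤ m ∧ z m ∉ Set.diagonal Ω} := measurableSet_notMerged_after k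
  have heq : μ.real {ω | ∃ m, k ≤ m ∧ Z j ω m ∉ Set.diagonal Ω} =
      (μ.map (Z j)).real {z : ℕ → Ω × Ω | ∃ m, k ≤ m ∧ z m ∉ Set.diagonal Ω} := by
    rw [measureReal_def, measureReal_def, Measure.map_apply (hZm j) hE]; rfl
  rw [heq, hlaw, measureReal_def, measureReal_def]
  exact ENNReal.toReal_mono (measure_ne_top _ _) (crn_chain_notMerged_after_le_offDiagonal hw hw0 Khat hK ν k)

omit [IsProbabilityMeasure μ] in
/-- **`P(∃ j < R, ∃ m ≥ k, X_m ≠ X′_m along Z_j) ≤ R·(ν̂K̂^k)(Δᶜ)`** for EVERY weight (union bound). [ours, bookkeeping] -/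
theorem crnLag_replicas_notMerged_after_le_offDiagonal [MeasurableEq Ω] (hw : Measurable w) (hw0 : ∀ y, 0 < w y)
    (Khat : Kernel (Ω × Ω) (Ω × Ω)) [IsMarkovKernel Khat]
    (hK : ∀ z : Ω × Ω, Khat z = (q.prod (volume : Measure unitInterval)).map (fun p : Ω × unitInterval =>
      ((if (p.2 : ℝ) * w z.1 ≤ w p.1 then p.1 else z.1), (if (p.2 : ℝ) * w z.2 ≤ w p.1 then p.1 else z.2))))
    (ν : Measure (Ω × Ω)) [IsProbabilityMeasure ν] (k : ℕ) (hZm : ∀ j, Measurable (Z j))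
    (hlaw : ∀ j, μ.map (Z j) = Kernel.trajMeasure (X := fun _ : ℕ => Ω × Ω) ν
      (fun n : ℕ => Khat.comap (fun h : (i : ↥(Finset.Iic n)) → Ω × Ω => h ⟨n, Finset.mem_Iic.2 le_rfl⟩)
        (measurable_pi_apply _))) (R : ℕ) :
    μ.real (⋃ j ∈ range R, {ω | ∃ m, k ≤ m ∧ Z j ω m ∉ Set.diagonal Ω}) ≤
      R * ((fun m : Measure (Ω × Ω) => m.bind Khat)^[k] ν).real (Set.diagonal Ω)ᶜ :=
  calc μ.real (⋃ j ∈ range R, {ω | ∃ m, k ≤ m ∧ Z j ω m ∉ Set.diagonal Ω})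
      ≤ ∑ j ∈ range R, μ.real {ω | ∃ m, k ≤ m ∧ Z j ω m ∉ Set.diagonal Ω} := measureReal_biUnion_finset_le _ _
    _ ≤ ∑ j ∈ range R, ((fun m : Measure (Ω × Ω) => m.bind Khat)^[k] ν).real (Set.diagonal Ω)ᶜ :=
        sum_le_sum fun j _ => crnLag_replica_notMerged_after_le_offDiagonal hw hw0 Khat hK ν k hZm (hlaw j)
    _ = R * ((fun m : Measure (Ω × Ω) => m.bind Khat)^[k] ν).real (Set.diagonal Ω)ᶜ := by
        rw [sum_const, card_range, nsmul_eq_mul]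

omit [MeasurableSpace Ω] in
/-- Off the event that some replica is not merged after the burn-in, the untruncated average IS the read-out average: for every
threshold `t` and centre `m`, `{t ≤ |R⁻¹Σ_j H_k(Z_j) − m|} ⊆ B ∪ {t ≤ |R⁻¹Σ_j f(Y_k^{(j)}) − m|}`. [ours, bookkeeping] -/
theorem untruncated_avg_subset_notMerged_union (f : Ω → ℝ) (k R : ℕ) (t m : ℝ) :
    {ω : Ω' | t ≤ |(R : ℝ)⁻¹ * ∑ j ∈ range R, (f ((Z j ω k).2) + ∑' n, (f ((Z j ω (k + n)).1) - f ((Z j ω (k + n)).2))) - m|} ⊆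
      (⋃ j ∈ range R, {ω | ∃ m, k ≤ m ∧ Z j ω m ∉ Set.diagonal Ω}) ∪
        {ω | t ≤ |(R : ℝ)⁻¹ * ∑ j ∈ range R, f ((Z j ω k).2) - m|} := by
  intro ω hω
  by_cases hωB : ω ∈ ⋃ j ∈ range R, {ω | ∃ m, k ≤ m ∧ Z j ω m ∉ Set.diagonal Ω}
  · exact Or.inl hωB
  · right
    have hzero : ∀ j ∈ range R, ∑' n, (f ((Z j ω (k + n)).1) - f ((Z j ω (k + n)).2)) = 0 := by
      intro j hj
      have hall : ∀ n, Z j ω (k + n) ∈ Set.diagonal Ω := fun n => by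
        by_contra hne
        exact hωB (Set.mem_biUnion (show j ∈ (range R : Set ℕ) from by exact_mod_cast hj) ⟨k + n, Nat.le_add_right k n, hne⟩)
      have hD : (fun n => f ((Z j ω (k + n)).1) - f ((Z j ω (k + n)).2)) = fun _ => 0 := funext fun n => by
        rw [Set.mem_diagonal_iff.1 (hall n), sub_self]
      rw [hD, tsum_zero]
    have hsum : ∑ j ∈ range R, (f ((Z j ω k).2) + ∑' n, (f ((Z j ω (k + n)).1) - f ((Z j ω (k + n)).2))) =
        ∑ j ∈ range R, f ((Z j ω k).2) := sum_congr rfl fun j hj => by rw [hzero j hj, add_zero]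
    simp only [Set.mem_setOf_eq] at hω ⊢
    rwa [hsum] at hω

/-! ## §2 From every initial coupling, about `m_k` — no weight hypothesis -/

/-- **HOEFFDING FOR THE EXACTLY UNBIASED ESTIMATOR, EVERY WEIGHT**: `P(|R⁻¹Σ_j H_k(Z_j) − (ν̂₂K^k) f| ≥ ε) ≤ 2·exp(−2Rε²/(c − a)²) + R·(ν̂K̂^k)(Δᶜ)`
for `ε ≥ 0`, `R ≥ 1`. [ours] -/
theorem crnLag_untruncated_replicas_burnIn_hoeffding_abs_everyWeight [MeasurableEq Ω] [Fact (Measurable w)] (hw0 : ∀ y, 0 < w y)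
    (Khat : Kernel (Ω × Ω) (Ω × Ω)) [IsMarkovKernel Khat]
    (hK : ∀ z : Ω × Ω, Khat z = (q.prod (volume : Measure unitInterval)).map (fun p : Ω × unitInterval =>
      ((if (p.2 : ℝ) * w z.1 ≤ w p.1 then p.1 else z.1), (if (p.2 : ℝ) * w z.2 ≤ w p.1 then p.1 else z.2))))
    (ν : Measure (Ω × Ω)) [IsProbabilityMeasure ν] {f : Ω → ℝ} (hf : Measurable f) {a c : ℝ} (ha : ∀ x, a ≤ f x)
    (hc : ∀ x, f x ≤ c) (k : ℕ) (hZm : ∀ j, Measurable (Z j))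
    (hlaw : ∀ j, μ.map (Z j) = Kernel.trajMeasure (X := fun _ : ℕ => Ω × Ω) ν
      (fun n : ℕ => Khat.comap (fun h : (i : ↥(Finset.Iic n)) → Ω × Ω => h ⟨n, Finset.mem_Iic.2 le_rfl⟩)
        (measurable_pi_apply _)))
    (hind : iIndepFun Z μ) {ε : ℝ} (hε : 0 ≤ ε) {R : ℕ} (hR : 1 ≤ R) :
    μ.real {ω | ε ≤ |(R : ℝ)⁻¹ * ∑ j ∈ range R, (f ((Z j ω k).2) + ∑' n, (f ((Z j ω (k + n)).1) - f ((Z j ω (k + n)).2))) -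
        ∫ y, f y ∂((fun m : Measure Ω => m.bind (indepMH q w))^[k] (ν.map Prod.snd))|} ≤
      2 * Real.exp (-(2 * R * ε ^ 2) / (c - a) ^ 2) + R * ((fun m : Measure (Ω × Ω) => m.bind Khat)^[k] ν).real (Set.diagonal Ω)ᶜ := by
  have hw : Measurable w := Fact.out
  set mk := ∫ y, f y ∂((fun m : Measure Ω => m.bind (indepMH q w))^[k] (ν.map Prod.snd)) with hmk
  have h1 := crnLag_replicas_notMerged_after_le_offDiagonal hw hw0 Khat hK ν k hZm hlaw R
  have h2 := crnLag_replicas_readout_hoeffding_abs hw0 Khat hK ν hf ha hc k hZm hlaw hind hε hR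
  calc μ.real {ω | ε ≤ |(R : ℝ)⁻¹ * ∑ j ∈ range R, (f ((Z j ω k).2) + ∑' n, (f ((Z j ω (k + n)).1) - f ((Z j ω (k + n)).2))) - mk|}
      ≤ μ.real ((⋃ j ∈ range R, {ω | ∃ m, k ≤ m ∧ Z j ω m ∉ Set.diagonal Ω}) ∪
          {ω | ε ≤ |(R : ℝ)⁻¹ * ∑ j ∈ range R, f ((Z j ω k).2) - mk|}) :=
        measureReal_mono (untruncated_avg_subset_notMerged_union f k R ε mk)
    _ ≤ μ.real (⋃ j ∈ range R, {ω | ∃ m, k ≤ m ∧ Z j ω m ∉ Set.diagonal Ω}) +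
          μ.real {ω | ε ≤ |(R : ℝ)⁻¹ * ∑ j ∈ range R, f ((Z j ω k).2) - mk|} := measureReal_union_le _ _
    _ ≤ 2 * Real.exp (-(2 * R * ε ^ 2) / (c - a) ^ 2) + R * ((fun m : Measure (Ω × Ω) => m.bind Khat)^[k] ν).real (Set.diagonal Ω)ᶜ := by
        linarith

/-- **BERNSTEIN FOR THE EXACTLY UNBIASED ESTIMATOR, EVERY WEIGHT**: for `σ² ≥ Var_{ν̂₂K^k} f` with `σ² > 0`, `ε ≥ 0`, `R ≥ 1`:
`P(|R⁻¹Σ_j H_k(Z_j) − (ν̂₂K^k) f| ≥ ε) ≤ 2·exp(−Rε²/(2(σ² + (c − a)ε/3))) + R·(ν̂K̂^k)(Δᶜ)`. [ours] -/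
theorem crnLag_untruncated_replicas_burnIn_bernstein_abs_everyWeight [MeasurableEq Ω] [Fact (Measurable w)] (hw0 : ∀ y, 0 < w y)
    (Khat : Kernel (Ω × Ω) (Ω × Ω)) [IsMarkovKernel Khat]
    (hK : ∀ z : Ω × Ω, Khat z = (q.prod (volume : Measure unitInterval)).map (fun p : Ω × unitInterval =>
      ((if (p.2 : ℝ) * w z.1 ≤ w p.1 then p.1 else z.1), (if (p.2 : ℝ) * w z.2 ≤ w p.1 then p.1 else z.2))))
    (ν : Measure (Ω × Ω)) [IsProbabilityMeasure ν] {f : Ω → ℝ} (hf : Measurable f) {a c : ℝ} (ha : ∀ x, a ≤ f x)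
    (hc : ∀ x, f x ≤ c) (k : ℕ) (hZm : ∀ j, Measurable (Z j))
    (hlaw : ∀ j, μ.map (Z j) = Kernel.trajMeasure (X := fun _ : ℕ => Ω × Ω) ν
      (fun n : ℕ => Khat.comap (fun h : (i : ↥(Finset.Iic n)) → Ω × Ω => h ⟨n, Finset.mem_Iic.2 le_rfl⟩)
        (measurable_pi_apply _)))
    (hind : iIndepFun Z μ) {σ2 : ℝ} (hσ : 0 < σ2)
    (hσk : variance f ((fun m : Measure Ω => m.bind (indepMH q w))^[k] (ν.map Prod.snd)) ≤ σ2)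
    {ε : ℝ} (hε : 0 ≤ ε) {R : ℕ} (hR : 1 ≤ R) :
    μ.real {ω | ε ≤ |(R : ℝ)⁻¹ * ∑ j ∈ range R, (f ((Z j ω k).2) + ∑' n, (f ((Z j ω (k + n)).1) - f ((Z j ω (k + n)).2))) -
        ∫ y, f y ∂((fun m : Measure Ω => m.bind (indepMH q w))^[k] (ν.map Prod.snd))|} ≤
      2 * Real.exp (-(R * ε ^ 2) / (2 * (σ2 + (c - a) * ε / 3))) +
        R * ((fun m : Measure (Ω × Ω) => m.bind Khat)^[k] ν).real (Set.diagonal Ω)ᶜ := by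
  have hw : Measurable w := Fact.out
  set mk := ∫ y, f y ∂((fun m : Measure Ω => m.bind (indepMH q w))^[k] (ν.map Prod.snd)) with hmk
  have h1 := crnLag_replicas_notMerged_after_le_offDiagonal hw hw0 Khat hK ν k hZm hlaw R
  have h2 := crnLag_replicas_readout_bernstein_abs hw0 Khat hK ν hf ha hc k hZm hlaw hind hσ hσk hε hR
  calc μ.real {ω | ε ≤ |(R : ℝ)⁻¹ * ∑ j ∈ range R, (f ((Z j ω k).2) + ∑' n, (f ((Z j ω (k + n)).1) - f ((Z j ω (k + n)).2))) - mk|}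
      ≤ μ.real ((⋃ j ∈ range R, {ω | ∃ m, k ≤ m ∧ Z j ω m ∉ Set.diagonal Ω}) ∪
          {ω | ε ≤ |(R : ℝ)⁻¹ * ∑ j ∈ range R, f ((Z j ω k).2) - mk|}) :=
        measureReal_mono (untruncated_avg_subset_notMerged_union f k R ε mk)
    _ ≤ μ.real (⋃ j ∈ range R, {ω | ∃ m, k ≤ m ∧ Z j ω m ∉ Set.diagonal Ω}) +
          μ.real {ω | ε ≤ |(R : ℝ)⁻¹ * ∑ j ∈ range R, f ((Z j ω k).2) - mk|} := measureReal_union_le _ _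
    _ ≤ 2 * Real.exp (-(R * ε ^ 2) / (2 * (σ2 + (c - a) * ε / 3))) +
          R * ((fun m : Measure (Ω × Ω) => m.bind Khat)^[k] ν).real (Set.diagonal Ω)ᶜ := by linarith

/-! ## §3 The practical start, about `π f` -/

/-- **HOEFFDING FOR THE EXACTLY UNBIASED ESTIMATOR ABOUT `π f` — EVERY WEIGHT, EVERY PROPOSAL LAW**: standard Borel `Ω`; production run at
`x` with `w(x) ≤ M`, leading run one update ahead; `τ = π{M < w} + ρ^k`, `ρ = 1 − c₁/max(1, M)`; for `ε ≥ 0`, `R ≥ 1`: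
`P(|R⁻¹Σ_j H_k(Z_j) − π f| ≥ ε + (c − a)τ) ≤ 2·exp(−2Rε²/(c − a)²) + R·(q{M < w} + ρ^k)`. [ours] -/
theorem crnLag_untruncated_replicas_burnIn_hoeffding_abs_target_everyWeight [StandardBorelSpace Ω] [Nonempty Ω]
    [MeasurableSingletonClass Ω] [MeasurableEq Ω] [Fact (Measurable w)] (hw0 : ∀ y, 0 < w y)
    [IsProbabilityMeasure (q.withDensity fun y => ENNReal.ofReal (w y))]
    (Khat : Kernel (Ω × Ω) (Ω × Ω)) [IsMarkovKernel Khat]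
    (hK : ∀ z : Ω × Ω, Khat z = (q.prod (volume : Measure unitInterval)).map (fun p : Ω × unitInterval =>
      ((if (p.2 : ℝ) * w z.1 ≤ w p.1 then p.1 else z.1), (if (p.2 : ℝ) * w z.2 ≤ w p.1 then p.1 else z.2))))
    (x : Ω) {M : ℝ} (hxM : w x ≤ M) (ν : Measure (Ω × Ω)) [IsProbabilityMeasure ν]
    (hν : ν = (indepMH q w x).map fun y : Ω => (y, x)) {f : Ω → ℝ} (hf : Measurable f) {a c : ℝ} (ha : ∀ y, a ≤ f y)
    (hc : ∀ y, f y ≤ c) (k : ℕ) (hZm : ∀ j, Measurable (Z j))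
    (hlaw : ∀ j, μ.map (Z j) = Kernel.trajMeasure (X := fun _ : ℕ => Ω × Ω) ν
      (fun n : ℕ => Khat.comap (fun h : (i : ↥(Finset.Iic n)) → Ω × Ω => h ⟨n, Finset.mem_Iic.2 le_rfl⟩)
        (measurable_pi_apply _)))
    (hind : iIndepFun Z μ) {ε : ℝ} (hε : 0 ≤ ε) {R : ℕ} (hR : 1 ≤ R) :
    μ.real {ω | ε + (c - a) * ((q.withDensity fun y => ENNReal.ofReal (w y)) {y | M < w y} +
          (1 - (∫⁻ u, ENNReal.ofReal (min 1 (w u)) ∂q) / ENNReal.ofReal (max 1 M)) ^ k).toReal ≤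
        |(R : ℝ)⁻¹ * ∑ j ∈ range R, (f ((Z j ω k).2) + ∑' n, (f ((Z j ω (k + n)).1) - f ((Z j ω (k + n)).2))) -
          ∫ y, f y ∂(q.withDensity fun y => ENNReal.ofReal (w y))|} ≤
      2 * Real.exp (-(2 * R * ε ^ 2) / (c - a) ^ 2) +
        R * (q {y | M < w y} + (1 - (∫⁻ u, ENNReal.ofReal (min 1 (w u)) ∂q) / ENNReal.ofReal (max 1 M)) ^ k).toReal := by
  have hw : Measurable w := Fact.out
  have hφ : Measurable fun y : Ω => (y, x) := measurable_id.prodMk measurable_const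
  set c₁ := ∫⁻ u, ENNReal.ofReal (min 1 (w u)) ∂q with hc₁
  set r : ℝ≥0∞ := (1 - c₁ / ENNReal.ofReal (max 1 M)) ^ k with hr
  have hr1 : r ≤ 1 := (pow_le_pow_left' tsub_le_self k).trans_eq (one_pow k)
  have hsnd : ν.map Prod.snd = Measure.dirac x := by
    rw [hν, Measure.map_map measurable_snd hφ]
    have : (Prod.snd ∘ fun y : Ω => (y, x)) = fun _ => x := rfl
    rw [this, Measure.map_const, measure_univ, one_smul]
  set πm : Measure Ω := q.withDensity fun y => ENNReal.ofReal (w y) with hπm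
  set mk := ∫ y, f y ∂((fun m : Measure Ω => m.bind (indepMH q w))^[k] (Measure.dirac x)) with hmk
  set πf := ∫ y, f y ∂πm with hπf
  set X : ℕ → Ω' → ℝ := fun j ω => f ((Z j ω k).2) + ∑' n, (f ((Z j ω (k + n)).1) - f ((Z j ω (k + n)).2)) with hX
  have h := crnLag_untruncated_replicas_burnIn_hoeffding_abs_everyWeight hw0 Khat hK ν hf ha hc k hZm hlaw hind hε hR
  rw [hsnd] at h
  have hoff : ((fun m : Measure (Ω × Ω) => m.bind Khat)^[k] ν).real (Set.diagonal Ω)ᶜ ≤ (q {y | M < w y} + r).toReal := by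
    rw [measureReal_def]
    exact ENNReal.toReal_mono (ENNReal.add_ne_top.2 ⟨measure_ne_top q _, ne_top_of_le_ne_top ENNReal.one_ne_top hr1⟩)
      (iterate_bind_crnPair_offDiagonal_detLag_le_tail hw hw0 Khat hK x hxM ν hν k)
  have hbias : |mk - πf| ≤ (c - a) * (πm {y | M < w y} + r).toReal := by
    have hb := imh_everyStart_integral_sub_abs_le_tail (q := q) hw hw0 x hf ha hc k M
    rw [max_eq_right hxM, abs_sub_comm] at hb
    exact hb
  have hsub : {ω | ε + (c - a) * (πm {y | M < w y} + r).toReal ≤ |(R : ℝ)⁻¹ * ∑ j ∈ range R, X j ω - πf|} ⊆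
      {ω | ε ≤ |(R : ℝ)⁻¹ * ∑ j ∈ range R, X j ω - mk|} := by
    intro ω hω
    simp only [Set.mem_setOf_eq] at hω ⊢
    have htri : |(R : ℝ)⁻¹ * ∑ j ∈ range R, X j ω - πf| ≤ |(R : ℝ)⁻¹ * ∑ j ∈ range R, X j ω - mk| + |mk - πf| :=
      abs_sub_le ((R : ℝ)⁻¹ * ∑ j ∈ range R, X j ω) mk πf
    linarith
  have hRnn : (0 : ℝ) ≤ R := Nat.cast_nonneg R
  calc μ.real {ω | ε + (c - a) * (πm {y | M < w y} + r).toReal ≤ |(R : ℝ)⁻¹ * ∑ j ∈ range R, X j ω - πf|}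
      ≤ μ.real {ω | ε ≤ |(R : ℝ)⁻¹ * ∑ j ∈ range R, X j ω - mk|} := measureReal_mono hsub
    _ ≤ 2 * Real.exp (-(2 * R * ε ^ 2) / (c - a) ^ 2) + R * ((fun m : Measure (Ω × Ω) => m.bind Khat)^[k] ν).real (Set.diagonal Ω)ᶜ := h
    _ ≤ 2 * Real.exp (-(2 * R * ε ^ 2) / (c - a) ^ 2) + R * (q {y | M < w y} + r).toReal := by gcongr

/-- **THE EQUILIBRIUM BERNSTEIN BAR FOR THE EXACTLY UNBIASED ESTIMATOR — EVERY WEIGHT, EVERY PROPOSAL LAW**: standard Borel `Ω`;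
production run at `x` with `w(x) ≤ M`, leading run one update ahead; `τ = π{M < w} + ρ^k`, `ρ = 1 − c₁/max(1, M)`,
`Var_π f + 3(c − a)²τ > 0`; for `ε ≥ 0`, `R ≥ 1`:
`P(|R⁻¹Σ_j H_k(Z_j) − π f| ≥ ε + (c − a)τ) ≤ 2·exp(−Rε²/(2(Var_π f + 3(c − a)²τ + (c − a)ε/3))) + R·(q{M < w} + ρ^k)`. [ours] -/
theorem crnLag_untruncated_replicas_burnIn_bernstein_abs_target_equilibrium_everyWeight [StandardBorelSpace Ω] [Nonempty Ω]
    [MeasurableSingletonClass Ω] [MeasurableEq Ω] [Fact (Measurable w)] (hw0 : ∀ y, 0 < w y)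
    [IsProbabilityMeasure (q.withDensity fun y => ENNReal.ofReal (w y))]
    (Khat : Kernel (Ω × Ω) (Ω × Ω)) [IsMarkovKernel Khat]
    (hK : ∀ z : Ω × Ω, Khat z = (q.prod (volume : Measure unitInterval)).map (fun p : Ω × unitInterval =>
      ((if (p.2 : ℝ) * w z.1 ≤ w p.1 then p.1 else z.1), (if (p.2 : ℝ) * w z.2 ≤ w p.1 then p.1 else z.2))))
    (x : Ω) {M : ℝ} (hxM : w x ≤ M) (ν : Measure (Ω × Ω)) [IsProbabilityMeasure ν]
    (hν : ν = (indepMH q w x).map fun y : Ω => (y, x)) {f : Ω → ℝ} (hf : Measurable f) {a c : ℝ} (ha : ∀ y, a ≤ f y)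
    (hc : ∀ y, f y ≤ c) (k : ℕ) (hZm : ∀ j, Measurable (Z j))
    (hlaw : ∀ j, μ.map (Z j) = Kernel.trajMeasure (X := fun _ : ℕ => Ω × Ω) ν
      (fun n : ℕ => Khat.comap (fun h : (i : ↥(Finset.Iic n)) → Ω × Ω => h ⟨n, Finset.mem_Iic.2 le_rfl⟩)
        (measurable_pi_apply _)))
    (hind : iIndepFun Z μ)
    (hσ : 0 < variance f (q.withDensity fun y => ENNReal.ofReal (w y)) +
      3 * ((c - a) ^ 2 * ((q.withDensity fun y => ENNReal.ofReal (w y)) {y | M < w y} +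
        (1 - (∫⁻ u, ENNReal.ofReal (min 1 (w u)) ∂q) / ENNReal.ofReal (max 1 M)) ^ k).toReal))
    {ε : ℝ} (hε : 0 ≤ ε) {R : ℕ} (hR : 1 ≤ R) :
    μ.real {ω | ε + (c - a) * ((q.withDensity fun y => ENNReal.ofReal (w y)) {y | M < w y} +
          (1 - (∫⁻ u, ENNReal.ofReal (min 1 (w u)) ∂q) / ENNReal.ofReal (max 1 M)) ^ k).toReal ≤
        |(R : ℝ)⁻¹ * ∑ j ∈ range R, (f ((Z j ω k).2) + ∑' n, (f ((Z j ω (k + n)).1) - f ((Z j ω (k + n)).2))) -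
          ∫ y, f y ∂(q.withDensity fun y => ENNReal.ofReal (w y))|} ≤
      2 * Real.exp (-(R * ε ^ 2) / (2 * (variance f (q.withDensity fun y => ENNReal.ofReal (w y)) +
          3 * ((c - a) ^ 2 * ((q.withDensity fun y => ENNReal.ofReal (w y)) {y | M < w y} +
            (1 - (∫⁻ u, ENNReal.ofReal (min 1 (w u)) ∂q) / ENNReal.ofReal (max 1 M)) ^ k).toReal) + (c - a) * ε / 3))) +
        R * (q {y | M < w y} + (1 - (∫⁻ u, ENNReal.ofReal (min 1 (w u)) ∂q) / ENNReal.ofReal (max 1 M)) ^ k).toReal := by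
  have hw : Measurable w := Fact.out
  have hφ : Measurable fun y : Ω => (y, x) := measurable_id.prodMk measurable_const
  set c₁ := ∫⁻ u, ENNReal.ofReal (min 1 (w u)) ∂q with hc₁
  set r : ℝ≥0∞ := (1 - c₁ / ENNReal.ofReal (max 1 M)) ^ k with hr
  have hr1 : r ≤ 1 := (pow_le_pow_left' tsub_le_self k).trans_eq (one_pow k)
  have hsnd : ν.map Prod.snd = Measure.dirac x := by
    rw [hν, Measure.map_map measurable_snd hφ]
    have : (Prod.snd ∘ fun y : Ω => (y, x)) = fun _ => x := rfl
    rw [this, Measure.map_const, measure_univ, one_smul]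
  set πm : Measure Ω := q.withDensity fun y => ENNReal.ofReal (w y) with hπm
  set mk := ∫ y, f y ∂((fun m : Measure Ω => m.bind (indepMH q w))^[k] (Measure.dirac x)) with hmk
  set πf := ∫ y, f y ∂πm with hπf
  set σ2 := variance f πm + 3 * ((c - a) ^ 2 * (πm {y | M < w y} + r).toReal) with hσ2
  set X : ℕ → Ω' → ℝ := fun j ω => f ((Z j ω k).2) + ∑' n, (f ((Z j ω (k + n)).1) - f ((Z j ω (k + n)).2)) with hX
  have hσk : variance f ((fun m : Measure Ω => m.bind (indepMH q w))^[k] (ν.map Prod.snd)) ≤ σ2 := by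
    have h := variance_iterate_bind_indepMH_dirac_le_tail (q := q) hw hw0 x hf ha hc k M
    rw [max_eq_right hxM] at h
    rw [hsnd]; exact h
  have h := crnLag_untruncated_replicas_burnIn_bernstein_abs_everyWeight hw0 Khat hK ν hf ha hc k hZm hlaw hind hσ hσk hε hR
  rw [hsnd] at h
  have hoff : ((fun m : Measure (Ω × Ω) => m.bind Khat)^[k] ν).real (Set.diagonal Ω)ᶜ ≤ (q {y | M < w y} + r).toReal := by
    rw [measureReal_def]
    exact ENNReal.toReal_mono (ENNReal.add_ne_top.2 ⟨measure_ne_top q _, ne_top_of_le_ne_top ENNReal.one_ne_top hr1⟩)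
      (iterate_bind_crnPair_offDiagonal_detLag_le_tail hw hw0 Khat hK x hxM ν hν k)
  have hbias : |mk - πf| ≤ (c - a) * (πm {y | M < w y} + r).toReal := by
    have hb := imh_everyStart_integral_sub_abs_le_tail (q := q) hw hw0 x hf ha hc k M
    rw [max_eq_right hxM, abs_sub_comm] at hb
    exact hb
  have hsub : {ω | ε + (c - a) * (πm {y | M < w y} + r).toReal ≤ |(R : ℝ)⁻¹ * ∑ j ∈ range R, X j ω - πf|} ⊆
      {ω | ε ≤ |(R : ℝ)⁻¹ * ∑ j ∈ range R, X j ω - mk|} := by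
    intro ω hω
    simp only [Set.mem_setOf_eq] at hω ⊢
    have htri : |(R : ℝ)⁻¹ * ∑ j ∈ range R, X j ω - πf| ≤ |(R : ℝ)⁻¹ * ∑ j ∈ range R, X j ω - mk| + |mk - πf| :=
      abs_sub_le ((R : ℝ)⁻¹ * ∑ j ∈ range R, X j ω) mk πf
    linarith
  have hRnn : (0 : ℝ) ≤ R := Nat.cast_nonneg R
  calc μ.real {ω | ε + (c - a) * (πm {y | M < w y} + r).toReal ≤ |(R : ℝ)⁻¹ * ∑ j ∈ range R, X j ω - πf|}
      ≤ μ.real {ω | ε ≤ |(R : ℝ)⁻¹ * ∑ j ∈ range R, X j ω - mk|} := measureReal_mono hsub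
    _ ≤ 2 * Real.exp (-(R * ε ^ 2) / (2 * (σ2 + (c - a) * ε / 3))) +
          R * ((fun m : Measure (Ω × Ω) => m.bind Khat)^[k] ν).real (Set.diagonal Ω)ᶜ := h
    _ ≤ 2 * Real.exp (-(R * ε ^ 2) / (2 * (σ2 + (c - a) * ε / 3))) + R * (q {y | M < w y} + r).toReal := by gcongr

end Replicas

end Summit.Ventures.LatticeQCDFlow.Exactness

end
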